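import Literature.NumberTheory.EllipticCurves.Greenberg1999.KummerImageGoodOrdinaryNumberField
import Literature.NumberTheory.EllipticCurves.IwasawaSelmerSupersingularSplit
import Literature.NumberTheory.EllipticCurves.SubgroupSelmerCocycleCriteriaProofs
import HarnessLib

/-!
# `H¹(L_w, E₁(K̄_v)) = 0 ⟹ Im(λ_{L_w}) ⊆ Im(κ_{L_w})`: the formal (Tate-direction) step of
# Greenberg's Prop. 2.4 for the CANONICAL datum `C_v = E[p^∞] ∩ E₁(K̄_v)` over a number field

Topic `NumberTheory/EllipticCurves`; THEOREMS ONLY (no definition, no named fact, no instance, no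
`sorry`); route-independent (no `Summits` import). Cell `pub/bsd-print-x9`, road CG-FRAME (pen g14
«GO w3: CG-FRAME» 2026-08-29T00:29:56Z, owner x9-p1-w3 g11), file (D) (seat x10b-p1-w7 g4).

## What

Let `K` be a number field, `E = W` a Weierstrass curve over `K`, `p : ℕ`, `v` a finite place of
`K`, `K_v` its completion, `E₁(K̄_v) = W.localKernelOfReduction v ≤ E(K̄_v)` the kernel of reduction
at `v` (file `IwasawaSelmerSupersingularLocalProofs`), and `C_v = W.kernelOfReductionLocalDatum p v`
the CANONICAL Greenberg datum `{m ∈ E[p^∞] : ι m ∈ E₁(K̄_v)}` (file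
`Greenberg1999/KummerImageGoodOrdinaryNumberField`). For a subgroup `H ≤ Γ_K` (fixed field `L`)
write `H_v = localSubgroup H K_v ≤ Γ_{K_v}` (`= G_{L_w}` for the chosen place `w ∣ v` of `L`).

* `mem_localKerOver_iff_exists_localPoints` — cocycle criterion for the KUMMER condition
  `W.localKerOver p H K_v` (the class of `f : H → E[p^∞]` restricted to `H_v` and pushed into
  `E(K̄_v)` is a coboundary); the `K`-general twin of the Summits-side lemma
  `X2.GreenbergVatsalSelmerLink.oneCocycleClass_mem_localKerOver_iff` (same three-line proof).
* `mem_strictKer_iff_exists_gr` — cocycle criterion for the STRICT condition `N.strictKer H`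
  (`f mod M⁺_v` is principal on `H ⊓ D_v`); twin of
  `Additive.GoodModelLine.oneCocycleClass_mem_strictKer_iff`.
* **`strictKer_kernelOfReductionLocalDatum_le_localKerOver_of_forall_cocycle`** — THE STEP: if
  every continuous crossed homomorphism `H_v → E(K̄_v)` with values in `E₁(K̄_v)` is the coboundary
  of a point of `E₁(K̄_v)` («`H¹(L_w, 𝓕(𝔪̄)) = 0`» in the cocycle shape of the tree's record (I2)
  `WeierstrassCurve.CoatesGreenberg1996_H1_formalGroup_trivial`, hypothesis `hH1`), then
  `C_v.strictKer H ≤ W.localKerOver p H K_v` — Greenberg's `Im(λ_{L_w}) ⊆ Im(κ_{L_w})` pulled back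
  to `H¹(H, E[p^∞])`. MECHANISM (Greenberg, LNM 1716 p. 83 "just as in the case of Kummer theory
  for the multiplicative group"; the Summits-side S2 derivation
  `Additive.GoodModelLine.imKummer_ge_strictCondition_goodOrdinaryModel_of_coatesGreenberg`, here
  PORTED from (`ℚ`, a good model `W₀ = C • E`) to (`K`, the canonical kernel of reduction)): a strict
  class `[f]` has `f mod C_v = ∂m̄` on `H ⊓ D_v`; on `H_v` the cocycle `ψ = ι∘f∘res − ∂(ι m)` takes
  values in `ι(C_v) ⊆ E₁(K̄_v)`, so `ψ = ∂a` by `hH1`, whence `ι∘f∘res = ∂(a + ι m)`: the Kummer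
  condition. NO hypothesis on `W`, `p`, `v`, `H` beyond `hH1` (no good/ordinary reduction, no
  `ℤ_p`-tower, no frame): every arithmetic input enters through `hH1`.
* `strictKer_kernelOfReductionLocalDatum_le_localKerOver_of_H1_formalGroup_trivial` — the socket at
  `H = ker κ`, `κ` CYCLOTOMIC, `v ∣ p` of good reduction, fed by the record (I2) taken as a
  hypothesis (the record is a THEOREM of the tree, `…_of_goodModelKernel H1_goodModelKernel_trivial_holds`,
  but its discharge lives under `Summits/`, which a Literature file may not import).

## Why (consumer)

The cite-only leaf (CG) `Greenberg1999.imKummer_eq_strictCondition_goodOrdinary_numberField`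
(Greenberg LNM 1716 Prop. 2.4 for ramified `ℤ_p`-towers over number fields) is consumed by the
shared μ-crux chain of rows 9/10 of the cell ONLY through the equation
`KS(v) : localKerOver p (ker κ) K_v = (kernelOfReductionLocalDatum p v).strictKer (ker κ)` at the
good ordinary places `v ∣ p` of the anticyclotomic frame (consumers
`ZpExtensionEisensteinReadoutOrdinaryStrictProofs` l.206, `…OrdinaryPrincipalProofs` l.200). Its
`≥` half is THIS file's theorem fed with the anticyclotomic twin of (I2) (road file (C)); its `≤`
half is elementary (Prop. 2.2 (i), road file (A)). «beyond-print theorem»: no. BSD is not proved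
by any of this; no summit statement is proved by this seat.

References: [GreenbergLNM1716] R. Greenberg, *Iwasawa theory for elliptic curves*, LNM 1716
(1999), §2 Prop. 2.2, Prop. 2.4 (pp. 73–80), p. 83; [CoatesGreenberg1996] J. Coates,
R. Greenberg, Invent. Math. 124 (1996), Cor. 3.2, Prop. 4.3; [Greenberg1989] R. Greenberg,
Adv. Stud. Pure Math. 17 (1989) p. 98 (strict condition); [SerreGaloisCohomology1997] I.§2,
II.§1.1.
-/

noncomputable section

open scoped Classical NNReal

universe u

namespace Literature.NumberTheory.EllipticCurves

open NumberField IsDedekindDomain Field WeierstrassCurve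
  Literature.NumberTheory.GaloisRepresentations
  Literature.NumberTheory.EllipticCurves.GreenbergSelmer

/-! ## §1 Cocycle criteria for the Kummer and the strict local conditions -/

section Criteria

variable {K : Type u} [Field K] (W : WeierstrassCurve K) (p : ℕ)
  (H : Subgroup (absoluteGaloisGroup K)) (E : Type u) [Field E] [Algebra K E]

/-- **Cocycle criterion for the Kummer local condition** `W.localKerOver p H E` (the class dies in
`H¹(H_E, E(K̄_E))`, `H_E = (Γ_E → Γ_K)⁻¹(H)`): the class of `f : H → E[p^∞]` satisfies it iff there
is `P ∈ E(K̄_E)` with `ι f(res τ) = τ • P - P` for all `τ ∈ H_E`. `K`-general twin of the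
Summits-side `X2.GreenbergVatsalSelmerLink.oneCocycleClass_mem_localKerOver_iff`.
Serre, *Galois Cohomology*, I.§2.4 and II.§1.1; Greenberg, LNM 1716 §2 (the Kummer condition
`Im κ`). [cite: SerreGaloisCohomology1997, I §2.4 (compatible pairs)] -/
theorem mem_localKerOver_iff_exists_localPoints
    (f : contOneCocycles (discreteTopRep H (W.geomPrimaryTorsion p))) :
    oneCocycleClass (discreteTopRep H (W.geomPrimaryTorsion p)) f ∈ W.localKerOver p H E ↔
      ∃ P : localPoints W E, ∀ τ : localSubgroup H E,
        pointsMap W E ((f.1 (resGalSubgroup H E τ) : W.geomPrimaryTorsion p) : W.geomPoints) =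
          (τ : absoluteGaloisGroup E) • P - P := by
  rw [WeierstrassCurve.mem_localKerOver_iff, WeierstrassCurve.localResOver,
    WeierstrassCurve.localResOverOfEmb]
  exact CocycleCriteria.resH1Hom_oneCocycleClass_eq_zero_iff _ _ _ f

variable [NumberField K] (M : Type u) [AddCommGroup M] [DistribMulAction (absoluteGaloisGroup K) M]
  [TopologicalSpace M] [DiscreteTopology M]

/-- **Cocycle criterion for the STRICT condition at `v`**: the class of `f : H → M` lies in
`N.strictKer H` iff `f mod M⁺_v` is principal on `H ⊓ D_v` with values in `M ⧸ M⁺_v`. `Literature`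
twin of the Summits-side `Additive.GoodModelLine.oneCocycleClass_mem_strictKer_iff`.
[cite: Greenberg1989, §1 p. 98] -/
theorem mem_strictKer_iff_exists_gr {v : HeightOneSpectrum (𝓞 K)} (N : LocalDatum K M v)
    (f : contOneCocycles (discreteTopRep H M)) :
    oneCocycleClass (discreteTopRep H M) f ∈ N.strictKer H ↔
      ∃ q : N.Gr, ∀ x : decompIn H v, N.grMk (f.1 (decompInToH H v x)) = x • q - q := by
  rw [LocalDatum.mem_strictKer_iff, LocalDatum.strictMap,
    CocycleCriteria.resH1Hom_oneCocycleClass_eq_zero_iff]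

end Criteria

/-! ## §2 The step: `H¹(H_v, E₁(K̄_v)) = 0` ⟹ strict classes are Kummer -/

section Main

variable {K : Type} [Field K] [NumberField K] (W : WeierstrassCurve K) (p : ℕ)
  (H : Subgroup (absoluteGaloisGroup K)) (v : HeightOneSpectrum (𝓞 K))

/-- **`H¹(L_w, E₁(K̄_v)) = 0` implies `Im(λ_{L_w}) ⊆ Im(κ_{L_w})` for the canonical datum
`C_v = E[p^∞] ∩ E₁(K̄_v)`** (Greenberg's Prop. 2.4, the Tate / Coates–Greenberg direction, as a
FORMAL step over an arbitrary number field `K`, an arbitrary Weierstrass curve, an arbitrary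
subgroup `H ≤ Γ_K` and an arbitrary finite place `v`): if every continuous crossed homomorphism
`H_v → E(K̄_v)` (`H_v = localSubgroup H K_v`) with values in the kernel of reduction
`E₁(K̄_v) = W.localKernelOfReduction v` is the coboundary of a point of `E₁(K̄_v)` (`hH1`, the
cocycle shape of the record (I2) `WeierstrassCurve.CoatesGreenberg1996_H1_formalGroup_trivial`),
then every class of `H¹(H, E[p^∞])` that is STRICT at `v` for
`W.kernelOfReductionLocalDatum p v` is KUMMER at `v`:
`(W.kernelOfReductionLocalDatum p v).strictKer H ≤ W.localKerOver p H K_v`. Proof: for a strict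
class `[f]`, `f mod C_v = ∂m̄` on `H ⊓ D_v`; the cocycle `ψ = ι∘f∘res − ∂(ι m)` of `H_v` takes
values in `ι(C_v) ⊆ E₁(K̄_v)` (definition of the canonical datum), so `ψ = ∂a` (`hH1`) and
`ι∘f∘res = ∂(a + ι m)`. Port of the Summits-side S2 derivation
`Additive.GoodModelLine.imKummer_ge_strictCondition_goodOrdinaryModel_of_coatesGreenberg`
(`K = ℚ`, good models) to number fields and the canonical kernel of reduction.
[cite: GreenbergLNM1716, §2 Prop. 2.4 (pp. 79–80) and p. 83] -/
theorem strictKer_kernelOfReductionLocalDatum_le_localKerOver_of_forall_cocycle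
    (hH1 : ∀ φ : contOneCocycles (discreteTopRep (localSubgroup H (v.adicCompletion K))
        (localPoints W (v.adicCompletion K))),
      (∀ g, φ.1 g ∈ W.localKernelOfReduction v) →
        ∃ a ∈ W.localKernelOfReduction v, ∀ g, φ.1 g = g • a - a) :
    (W.kernelOfReductionLocalDatum p v).strictKer H ≤
      W.localKerOver p H (v.adicCompletion K) := by
  intro c hc
  obtain ⟨f, rfl⟩ := oneCocycleClass_surjective (discreteTopRep H (W.geomPrimaryTorsion p)) c
  set N : LocalDatum K (W.geomPrimaryTorsion p) v := W.kernelOfReductionLocalDatum p v with hNdef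
  obtain ⟨q, hq⟩ := (mem_strictKer_iff_exists_gr H _ N f).1 hc
  obtain ⟨m, rfl⟩ := N.grMk_surjective q
  -- notation
  set E := v.adicCompletion K with hE
  set G : Subgroup (absoluteGaloisGroup E) := localSubgroup H E with hG
  set ι : W.geomPoints →+ localPoints W E := pointsMap W E with hι
  -- the pulled-back cocycle `F τ = ι (f (res τ))` on `G = H_v`
  set F : contOneCocycles (discreteTopRep G (localPoints W E)) :=
    contOneCocycles.pullback (resGalSubgroup H E)
      (resHomOfEquivariant (resGalSubgroup H E)
        ((pointsMap W E).comp (W.geomPrimaryTorsion p).subtype) fun τ P ↦ by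
          simp only [AddMonoidHom.coe_comp, AddSubgroup.coe_subtype, Function.comp_apply,
            Subgroup.smul_def, resGalSubgroup_apply_coe,
            Literature.NumberTheory.EllipticCurves.primaryComponent.coe_smul]
          exact pointsMap_smul W E τ P) f with hF
  have hFapply : ∀ τ : G, F.1 τ = ι ((f.1 (resGalSubgroup H E τ) : W.geomPrimaryTorsion p) :
      W.geomPoints) := fun τ ↦ rfl
  -- the coboundary of `ι m`
  have hcont : Continuous fun τ : G ↦ τ • ι (m : W.geomPoints) := by
    have hc : Continuous ((fun σ : absoluteGaloisGroup E ↦ σ • ι (m : W.geomPoints)) ∘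
        (Subtype.val : G → absoluteGaloisGroup E)) :=
      (continuous_smul_localPoints W E (ι (m : W.geomPoints))).comp continuous_subtype_val
    exact hc
  set ψ : contOneCocycles (discreteTopRep G (localPoints W E)) :=
    F - coboundaryCocycle (ι (m : W.geomPoints)) hcont with hψ
  -- each `τ ∈ H_v` gives an element of `H ⊓ D_v`
  have hyτ : ∀ τ : G, ∃ y : decompIn H v,
      decompInToH H v y = resGalSubgroup H E τ ∧
        ((y : decomp (K := K) v) : absoluteGaloisGroup K) = absGaloisRestrict K E τ := by
    intro τ
    have hτH : absGaloisRestrict K E τ ∈ H := (mem_localSubgroup_iff H E τ.1).1 τ.2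
    exact ⟨⟨⟨absGaloisRestrict K E τ, (mem_decomp_iff v _).2 ⟨τ, rfl⟩⟩,
      (mem_decompIn_iff H v _).2 hτH⟩, Subtype.ext rfl, rfl⟩
  -- `ψ τ = ι (f (res τ) - (res τ • m - m))` and the bracket lies in `C_v`
  have hψval : ∀ τ : G, ∃ n : W.geomPrimaryTorsion p, n ∈ N.plus ∧
      ψ.1 τ = ι (n : W.geomPoints) := by
    intro τ
    obtain ⟨y, hy, hy'⟩ := hyτ τ
    refine ⟨f.1 (resGalSubgroup H E τ) - (absGaloisRestrict K E τ • m - m), ?_, ?_⟩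
    · have hym : y • N.grMk m = N.grMk (absGaloisRestrict K E τ • m) := by
        rw [← hy']; rfl
      rw [← N.ker_grMk, AddMonoidHom.mem_ker, map_sub, map_sub, ← hy, hq y, hym]
      exact sub_self _
    · rw [hψ, cocycle_sub_apply, coboundaryCocycle_apply, hFapply]
      simp only [AddSubgroupClass.coe_sub, map_sub,
        Literature.NumberTheory.EllipticCurves.primaryComponent.coe_smul]
      have hsm : pointsMap W E (absGaloisRestrict K E (τ : absoluteGaloisGroup E) •
            (m : W.geomPoints)) = τ • pointsMap W E (m : W.geomPoints) :=
        pointsMap_smul W E (τ : absoluteGaloisGroup E) (m : W.geomPoints)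
      rw [hsm]
  -- hence `ψ` has values in the kernel of reduction `E₁(K̄_v)`
  have hkernel : ∀ τ : G, ψ.1 τ ∈ W.localKernelOfReduction v := by
    intro τ
    obtain ⟨n, hn, hψn⟩ := hψval τ
    rw [hψn]
    exact (W.mem_kernelOfReductionLocalDatum_plus_iff p v n).1 hn
  -- `H¹(H_v, E₁(K̄_v)) = 0`: `ψ` is the coboundary of some `a`
  obtain ⟨a, -, hφa⟩ := hH1 ψ hkernel
  -- so `F = ∂(a + ι m)`: the Kummer condition
  refine (mem_localKerOver_iff_exists_localPoints W p H E f).2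
    ⟨a + ι (m : W.geomPoints), fun τ ↦ ?_⟩
  have h := hφa τ
  rw [hψ, cocycle_sub_apply, coboundaryCocycle_apply, hFapply, sub_eq_iff_eq_add] at h
  change ι _ = _
  rw [h, Subgroup.smul_def, Subgroup.smul_def, smul_add]
  abel

end Main

/-! ## §3 The socket at the layer `K_∞` of the cyclotomic `ℤ_p`-extension (record (I2)) -/

section Cyclotomic

variable {K : Type} [Field K] [NumberField K] (W : WeierstrassCurve K) [W.IsElliptic]
  (p : ℕ) [Fact p.Prime] (κ : ZpExtension K p) (v : HeightOneSpectrum (𝓞 K))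

/-- **The cyclotomic instance** (`H = ker κ`, `κ` the CYCLOTOMIC `ℤ_p`-extension, `v ∣ p` of GOOD
reduction): granted the record (I2) `WeierstrassCurve.CoatesGreenberg1996_H1_formalGroup_trivial`
(`H¹(K_v K_∞, 𝓕(𝔪̄)) = 0`; a THEOREM of the tree through
`CoatesGreenberg1996_H1_formalGroup_trivial_of_goodModelKernel`, whose input is discharged under
`Summits/`), classes of `H¹(K_∞, E[p^∞])` strict at the place above `v` for the canonical datum
are Kummer there — the `Im λ ⊆ Im κ` half of Greenberg's Prop. 2.4 over `K_∞ = K(μ_{p^∞})⁺…`-type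
cyclotomic towers of an arbitrary number field, at any (ordinary OR supersingular) good `v ∣ p`.
[cite: GreenbergLNM1716, §2 Prop. 2.4 (pp. 79–80) and p. 83] -/
theorem strictKer_kernelOfReductionLocalDatum_le_localKerOver_of_H1_formalGroup_trivial
    (hI2 : WeierstrassCurve.CoatesGreenberg1996_H1_formalGroup_trivial.{0})
    (hκ : κ.IsCyclotomic) (hpv : ((p : ℕ) : 𝓞 K) ∈ v.asIdeal) (hgood : W.HasGoodReductionAt v) :
    (W.kernelOfReductionLocalDatum p v).strictKer κ.kerSubgroup ≤
      W.localKerOver p κ.kerSubgroup (v.adicCompletion K) :=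
  strictKer_kernelOfReductionLocalDatum_le_localKerOver_of_forall_cocycle W p κ.kerSubgroup v
    (hI2 K W p κ v hκ hpv hgood)

end Cyclotomic

end Literature.NumberTheory.EllipticCurves

end
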